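import Literature.NumberTheory.Weil1965.LocalQuadraticFibreDensityDecay
import Literature.NumberTheory.Weil1964.LocalLinearChangeOfVariables
import HarnessLib

/-!
# Homogeneity of the local fibre density of a diagonal quadratic form under similitudes
(Weil 1965, Chap. I n° 5–6 — behaviour of `F_Φ`, `F*_Φ` under automorphisms of `X`; finite places)

Topic `NumberTheory/Weil1965`; namespace `Literature.NumberTheory.Weil1965`.  KERNEL mathematics only (theorems; no
definition, no named fact, no `axiom`, no proof hole).  Companion of `LocalQuadraticFibreDensityDecay.lean` /
`LocalQuadraticFibreDensity.lean` (same notation: `G_Φ(β) = ∫ Φ(x) ψ(β f(x)) dμ^⊗ι` written out as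
`∫ x, Φ x * psiSqPi ψ (β • c) x ∂μ^⊗ι`, density `b ↦ 𝓕G_Φ(-b)` via Tate's `fourierSB`), independent of the continuity
files (no `r ≥ 3` needed here).

For a linear automorphism `e` of `X = F^ι` with `f(e x) = λ f(x)` (a SIMILITUDE of the diagonal form `f = Σ cᵢ xᵢ²`;
`λ = t²` for the dilation `x ↦ t x`, `λ = 1` for an isometry) the change of variables `y = e x` (module `‖det e‖`,
★ `integral_comp_linearEquiv`) and `β = λ β'` on `F` (★ `integral_comp_mul_left`) give

* `Φ ∘ e ∈ 𝒮(F^ι)` (`comp_linearEquiv_mem_schwartzBruhat`);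
* `G_{Φ∘e}(λβ) = ‖det e‖⁻¹ G_Φ(β)` (`integral_comp_linearEquiv_mul_psiSqPi`);
* **`𝓕G_{Φ∘e}(-b) = ‖λ‖ ‖det e‖⁻¹ 𝓕G_Φ(-λb)`** (`fourierSB_integral_comp_linearEquiv_mul_psiSqPi_neg`), whence
  INVARIANCE under isometries of unit module (`…_of_isometry`) and the DILATION RULE
  `𝓕G_{Φ(t·)}(-b) = ‖t²‖ ‖t^r‖⁻¹ 𝓕G_Φ(-t²b)` (`fourierSB_integral_comp_smul_mul_psiSqPi_neg`), i.e.
  `F_{Φ(t·)}(b) = ‖t‖^{2-r} F_Φ(t² b)` — the scaling of Weil's fibre measures `|θ_b|` under `x ↦ x λ_t` used in the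
  Siegel–Weil endgame at one place.

## References

* [Weil1965] A. Weil, *Sur la formule de Siegel dans la théorie des groupes classiques*, Acta Math. 113 (1965) 1–87:
  Chap. I n° 5–6 (pp. 14–16).
* [WeilBNT1967] A. Weil, *Basic Number Theory* (1967), Chap. I §2 Th. 3 Cor. 3 (module of an automorphism), Chap. VII
  §2 Prop. 2.
-/

set_option autoImplicit false

noncomputable section

open MeasureTheory ValuativeRel Filter Topology Set
open scoped NNReal ENNReal Pointwise
open Literature.NumberTheory.GaloisRepresentations.IsNonarchimedeanLocalField
open Literature.NumberTheory.Automorphic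
open Literature.NumberTheory.Weil1964

namespace Literature.NumberTheory.Weil1965

variable {F : Type*} [Field F] [ValuativeRel F] [TopologicalSpace F] [IsNonarchimedeanLocalField F]


section Homogeneity

variable {ι : Type*} [Fintype ι] [MeasurableSpace F] [BorelSpace F] (μ : Measure F) [μ.IsAddHaarMeasure]
  {ψ : AddChar F Circle}

omit [MeasurableSpace F] [BorelSpace F] in
/-- Schwartz–Bruhat functions on `F^ι` are stable under linear automorphisms: `Φ ∘ e ∈ 𝒮(F^ι)`.
[cite: WeilBNT1967, Ch. VII §2, Prop. 2] -/
theorem comp_linearEquiv_mem_schwartzBruhat {Φ : (ι → F) → ℂ} (hΦ : Φ ∈ SchwartzBruhat (ι → F))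
    (e : (ι → F) ≃ₗ[F] (ι → F)) : (Φ ∘ e) ∈ SchwartzBruhat (ι → F) := by
  rw [mem_schwartzBruhat_iff] at hΦ ⊢
  let eₕ : (ι → F) ≃ₜ (ι → F) :=
    { toEquiv := e.toEquiv
      continuous_toFun := LinearMap.continuous_on_pi (e : (ι → F) →ₗ[F] (ι → F))
      continuous_invFun := LinearMap.continuous_on_pi (e.symm : (ι → F) →ₗ[F] (ι → F)) }
  exact ⟨hΦ.1.comp_continuous (LinearMap.continuous_on_pi (e : (ι → F) →ₗ[F] (ι → F))), hΦ.2.comp_homeomorph eₕ⟩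

/-- **the Gauss transform under a similitude of the form**: if `f(e x) = λ f(x)` for all `x` (e.g. `e = t·id`,
`λ = t²`, or an isometry, `λ = 1`) then `G_{Φ∘e}(λβ) = ‖det e‖⁻¹ G_Φ(β)` (change of variables `y = e x`, module
`‖det e‖` ★ `integral_comp_linearEquiv`). [cite: Weil1965, Chap. I n° 5, p. 14] -/
theorem integral_comp_linearEquiv_mul_psiSqPi (c : ι → F) (Φ : (ι → F) → ℂ) (e : (ι → F) ≃ₗ[F] (ι → F)) {lam : F}
    (he : ∀ x, ∑ i, c i * (e x) i ^ 2 = lam * ∑ i, c i * x i ^ 2) (β : F) :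
    ∫ x, Φ (e x) * psiSqPi ψ (fun i => (lam * β) * c i) x ∂(Measure.pi fun _ : ι => μ) =
      ((normAbs F (LinearMap.det (e : (ι → F) →ₗ[F] (ι → F)))⁻¹ : ℝ≥0) : ℝ) •
        ∫ x, Φ x * psiSqPi ψ (fun i => β * c i) x ∂(Measure.pi fun _ : ι => μ) := by
  rw [← integral_comp_linearEquiv μ e]
  refine integral_congr_ae (Eventually.of_forall fun x => ?_)
  simp only [psiSqPi_smul_apply]
  rw [he x, show lam * β * ∑ i, c i * x i ^ 2 = β * (lam * ∑ i, c i * x i ^ 2) by ring]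

/-- **HOMOGENEITY OF THE FIBRE DENSITY under a similitude of the form** [Weil1965, Chap. I n° 5–6: behaviour of
`F_Φ` under automorphisms of `X`]: if `f(e x) = λ f(x)` (`λ ≠ 0`) then
`𝓕G_{Φ∘e}(-b) = ‖λ‖ ‖det e‖⁻¹ · 𝓕G_Φ(-λ b)`; for the dilation `x ↦ t x` of `F^r` this is `‖t‖^{2-r} F_Φ(t² b)`, and for
an isometry of `f` with `‖det e‖ = 1` it is the INVARIANCE of the fibre measures.
[cite: Weil1965, Chap. I n° 6, p. 16] -/
theorem fourierSB_integral_comp_linearEquiv_mul_psiSqPi_neg (c : ι → F) (Φ : (ι → F) → ℂ)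
    (e : (ι → F) ≃ₗ[F] (ι → F)) {lam : F} (hlam : lam ≠ 0)
    (he : ∀ x, ∑ i, c i * (e x) i ^ 2 = lam * ∑ i, c i * x i ^ 2) (b : F) :
    fourierSB ψ μ (fun β => ∫ x, Φ (e x) * psiSqPi ψ (fun i => β * c i) x ∂(Measure.pi fun _ : ι => μ)) (-b) =
      ((normAbs F lam * normAbs F (LinearMap.det (e : (ι → F) →ₗ[F] (ι → F)))⁻¹ : ℝ≥0) : ℝ) •
        fourierSB ψ μ (fun β => ∫ x, Φ x * psiSqPi ψ (fun i => β * c i) x ∂(Measure.pi fun _ : ι => μ)) (-(lam * b)) := by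
  rw [fourierSB_apply, fourierSB_apply]
  -- substitute `β = λ β'` on the left
  have hsub := integral_comp_mul_left μ hlam (fun β => ((ψ (β * -b) : Circle) : ℂ) *
    ∫ x, Φ (e x) * psiSqPi ψ (fun i => β * c i) x ∂(Measure.pi fun _ : ι => μ))
  -- `∫ φ(β) dβ = ‖λ‖ ∫ φ(λβ') dβ'`
  have e1 : ∫ β, ((ψ (β * -b) : Circle) : ℂ) * ∫ x, Φ (e x) * psiSqPi ψ (fun i => β * c i) x ∂(Measure.pi fun _ : ι => μ) ∂μ =
      ((normAbs F lam : ℝ≥0) : ℝ) • ∫ β, ((ψ (lam * β * -b) : Circle) : ℂ) *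
        ∫ x, Φ (e x) * psiSqPi ψ (fun i => lam * β * c i) x ∂(Measure.pi fun _ : ι => μ) ∂μ := by
    rw [hsub, smul_smul, map_inv₀, NNReal.coe_inv, mul_inv_cancel₀ (by exact_mod_cast (map_ne_zero (normAbs F)).2 hlam),
      one_smul]
  rw [e1]
  simp_rw [integral_comp_linearEquiv_mul_psiSqPi μ c Φ e he, Complex.real_smul]
  rw [NNReal.coe_mul, Complex.ofReal_mul, mul_assoc]
  congr 1
  rw [← integral_const_mul]
  refine integral_congr_ae (Eventually.of_forall fun β => ?_)
  simp only
  rw [show lam * β * -b = β * -(lam * b) by ring]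
  ring

/-- **INVARIANCE under isometries of unit module**: if `f(e x) = f(x)` and `‖det e‖ = 1` then the fibre density of `Φ ∘ e`
equals that of `Φ` — the fibre measures `μ_b` are invariant under the orthogonal group of `f` (for which `det e = ±1`).
[cite: Weil1965, Chap. I n° 6, p. 16] -/
theorem fourierSB_integral_comp_linearEquiv_mul_psiSqPi_neg_of_isometry (c : ι → F) (Φ : (ι → F) → ℂ)
    (e : (ι → F) ≃ₗ[F] (ι → F)) (he : ∀ x, ∑ i, c i * (e x) i ^ 2 = ∑ i, c i * x i ^ 2)
    (hdet : normAbs F (LinearMap.det (e : (ι → F) →ₗ[F] (ι → F))) = 1) (b : F) :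
    fourierSB ψ μ (fun β => ∫ x, Φ (e x) * psiSqPi ψ (fun i => β * c i) x ∂(Measure.pi fun _ : ι => μ)) (-b) =
      fourierSB ψ μ (fun β => ∫ x, Φ x * psiSqPi ψ (fun i => β * c i) x ∂(Measure.pi fun _ : ι => μ)) (-b) := by
  have h := fourierSB_integral_comp_linearEquiv_mul_psiSqPi_neg μ c Φ e one_ne_zero (lam := 1)
    (fun x => by rw [he x, one_mul]) b (ψ := ψ)
  rw [h, one_mul, map_one, map_inv₀, hdet, inv_one, one_mul, NNReal.coe_one, one_smul]

/-- **HOMOGENEITY under the dilations `x ↦ t x`** (`t ≠ 0`): `𝓕G_{Φ(t·)}(-b) = ‖t²‖ ‖t^r‖⁻¹ · 𝓕G_Φ(-t² b)`, i.e.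
`F_{Φ(t·)}(b) = ‖t‖^{2-r} F_Φ(t² b)` — Weil's scaling of the fibre measures under `x ↦ x λ_t` (the exponent `(−m+…)`
bookkeeping of the Siegel–Weil endgame at one place). [cite: Weil1965, Chap. I n° 6, p. 16] -/
theorem fourierSB_integral_comp_smul_mul_psiSqPi_neg (c : ι → F) (Φ : (ι → F) → ℂ) {t : F} (ht : t ≠ 0) (b : F) :
    fourierSB ψ μ (fun β => ∫ x, Φ (t • x) * psiSqPi ψ (fun i => β * c i) x ∂(Measure.pi fun _ : ι => μ)) (-b) =
      ((normAbs F (t ^ 2) * normAbs F (t ^ Fintype.card ι)⁻¹ : ℝ≥0) : ℝ) •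
        fourierSB ψ μ (fun β => ∫ x, Φ x * psiSqPi ψ (fun i => β * c i) x ∂(Measure.pi fun _ : ι => μ))
          (-(t ^ 2 * b)) := by
  set e : (ι → F) ≃ₗ[F] (ι → F) := LinearEquiv.smulOfNeZero F (ι → F) t ht with hedef
  have he_apply : ∀ x, e x = t • x := fun x => rfl
  have he : ∀ x, ∑ i, c i * (e x) i ^ 2 = t ^ 2 * ∑ i, c i * x i ^ 2 := by
    intro x
    rw [he_apply, Finset.mul_sum]
    refine Finset.sum_congr rfl fun i _ => ?_
    rw [Pi.smul_apply, smul_eq_mul]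
    ring
  have hdet : LinearMap.det (e : (ι → F) →ₗ[F] (ι → F)) = t ^ Fintype.card ι := by
    have hcoe : (e : (ι → F) →ₗ[F] (ι → F)) = t • LinearMap.id := by
      ext x i
      simp [he_apply]
    rw [hcoe, LinearMap.det_smul, LinearMap.det_id, mul_one, Module.finrank_fintype_fun_eq_card]
  have h := fourierSB_integral_comp_linearEquiv_mul_psiSqPi_neg μ c Φ e (pow_ne_zero 2 ht) he b (ψ := ψ)
  simp only [he_apply] at h
  rw [h, hdet]

end Homogeneity

end Literature.NumberTheory.Weil1965
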